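import Summits.RiemannHypothesis.RiemannHypothesis.Theses.Fences

/-!
# `ChainCount` — child 2 of the BC2-redirect split of `Fences.ClusterForcing`

Route item stmt-RiemannHypothesis-17856 (`Fences.ChainCount : ZeroChainStep → ClusterForcing`),
crux-strategist r1 (2026-08-17). PROOF: iterate the one-step statement `ZeroChainStep` along an
ordinate-increasing chain of zeros. With `β = b (loglog T)²/log T`, `d₀ = 0`,
`d_{j+1} = d_j + (a d_j + β)` one has `d_j = β((1+a)^j − 1)/a`; the chain continues while
`d_j ≤ D' = min(D, 1/4)`, i.e. for `k = ⌊log(1 + aD'/β)/log(1+a)⌋` steps, and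
`k + 1 ≥ loglog T/(2 log(1+a))` once `loglog T ≥ max(48 b/(a D'), 4)`. The `k + 1` zeros are
distinct (ordinates strictly increase), lie right of `Re ρ₀ − D' ≥ 1/2 + η` and within `1/4` of
`ρ₀` vertically. No ζ-theory is used: `riemannZeta ρ = 0` is an opaque predicate here.
-/

namespace Summit.RiemannHypothesis.RiemannHypothesis.Theorems

open Summit.RiemannHypothesis.RiemannHypothesis.Theses.Fences

/-- The depth recursion of the chain: `d₀ = 0`, `d_{j+1} = d_j + (a d_j + β)`. [folklore] -/
noncomputable def chainDepth (a β : ℝ) : ℕ → ℝ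
  | 0 => 0
  | j + 1 => chainDepth a β j + (a * chainDepth a β j + β)

theorem chainDepth_succ (a β : ℝ) (j : ℕ) :
    chainDepth a β (j + 1) = chainDepth a β j + (a * chainDepth a β j + β) := rfl

/-- Closed form `d_j = β((1+a)^j − 1)/a`. [folklore] -/
theorem chainDepth_eq {a : ℝ} (ha : a ≠ 0) (β : ℝ) (j : ℕ) :
    chainDepth a β j = β * ((1 + a) ^ j - 1) / a := by
  induction j with
  | zero => simp [chainDepth]
  | succ j ih =>
    rw [chainDepth_succ, ih]
    field_simp
    ring

theorem chainDepth_nonneg {a β : ℝ} (ha : 0 ≤ a) (hβ : 0 ≤ β) (j : ℕ) : 0 ≤ chainDepth a β j := by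
  induction j with
  | zero => simp [chainDepth]
  | succ j ih =>
    rw [chainDepth_succ]
    have : 0 ≤ a * chainDepth a β j := mul_nonneg ha ih
    linarith

theorem chainDepth_le_succ {a β : ℝ} (ha : 0 ≤ a) (hβ : 0 ≤ β) (j : ℕ) :
    chainDepth a β j ≤ chainDepth a β (j + 1) := by
  rw [chainDepth_succ]
  have : 0 ≤ a * chainDepth a β j := mul_nonneg ha (chainDepth_nonneg ha hβ j)
  linarith

/-- The elementary count: if `m ≥ 48 b/(a D')` and `m ≥ 0` then `b m² ≤ a D' exp(m/2)`. [folklore] -/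
theorem count_aux {a b D' m : ℝ} (ha : 0 < a) (_hb : 0 < b) (hD : 0 < D') (hm0 : 0 ≤ m)
    (hm : 48 * b / (a * D') ≤ m) : b * m ^ 2 ≤ a * D' * Real.exp (m / 2) := by
  have h1 : (m / 2) ^ 3 / (Nat.factorial 3) ≤ Real.exp (m / 2) :=
    Real.pow_div_factorial_le_exp (m / 2) (by linarith) 3
  have h3 : (Nat.factorial 3 : ℝ) = 6 := by norm_num [Nat.factorial]
  rw [h3] at h1
  have h2 : m ^ 3 / 48 ≤ Real.exp (m / 2) := by
    have : (m / 2) ^ 3 / 6 = m ^ 3 / 48 := by ring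
    linarith
  have haD : 0 < a * D' := mul_pos ha hD
  have hm' : 48 * b ≤ m * (a * D') := by rwa [div_le_iff₀ haD] at hm
  calc b * m ^ 2 = (48 * b) * m ^ 2 / 48 := by ring
    _ ≤ (m * (a * D')) * m ^ 2 / 48 := by gcongr
    _ = a * D' * (m ^ 3 / 48) := by ring
    _ ≤ a * D' * Real.exp (m / 2) := by gcongr

/-- **`ChainCount`** (route item stmt-RiemannHypothesis-17856): the one-step statement
`ZeroChainStep` implies `ClusterForcing`. [this work] -/
theorem chainCount_proof : ChainCount := by
  rintro ⟨a, ha, b, hb, w, hw1, hw2, hw3, hw4, hstep⟩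
  have hlog1a : 0 < Real.log (1 + a) := Real.log_pos (by linarith)
  refine ⟨1 / (2 * Real.log (1 + a)), by positivity, w, hw1, hw2, hw3, hw4, ?_⟩
  intro η hη
  obtain ⟨D, hD0, hDη, T₀, hT⟩ := hstep η hη
  set D' : ℝ := min D (1 / 4) with hD'_def
  have hD'0 : 0 < D' := lt_min hD0 (by norm_num)
  have hD'D : D' ≤ D := min_le_left _ _
  have hD'4 : D' ≤ 1 / 4 := min_le_right _ _
  set M : ℝ := max (48 * b / (a * D')) 4 with hM_def
  refine ⟨max T₀ (Real.exp (Real.exp M)), ?_⟩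
  intro T hTge hHYP ρ₀ hζ₀ hre₀ him₁ him₂ hapex
  have hT₀ : T₀ ≤ T := le_trans (le_max_left _ _) hTge
  have hT1 : Real.exp (Real.exp M) ≤ T := le_trans (le_max_right _ _) hTge
  have hTpos : 0 < T := lt_of_lt_of_le (Real.exp_pos _) hT1
  -- `L = log T`, `m = log L`
  set L : ℝ := Real.log T with hL_def
  have hL : Real.exp M ≤ L := by
    rw [hL_def, Real.le_log_iff_exp_le hTpos]; exact hT1
  have hLpos : 0 < L := lt_of_lt_of_le (Real.exp_pos _) hL
  set m : ℝ := Real.log L with hm_def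
  have hmM : M ≤ m := by
    rw [hm_def, Real.le_log_iff_exp_le hLpos]; exact hL
  have hm4 : 4 ≤ m := le_trans (le_max_right _ _) hmM
  have hm48 : 48 * b / (a * D') ≤ m := le_trans (le_max_left _ _) hmM
  have hm0 : 0 ≤ m := by linarith
  have hLexp : Real.exp m = L := by rw [hm_def, Real.exp_log hLpos]
  -- `β = b m² / L`
  set β : ℝ := b * m ^ 2 / L with hβ_def
  have hβpos : 0 < β := by
    rw [hβ_def]; exact div_pos (mul_pos hb (by positivity)) hLpos
  -- the step bound `a d + β` is literally the statement's `a * d + b * log(log T)^2 / log T`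
  have hg : ∀ d : ℝ, a * d + b * Real.log (Real.log T) ^ 2 / Real.log T = a * d + β := by
    intro d; rfl
  -- the chain, by induction on `j` while `d_j ≤ D'`
  have hchain : ∀ j : ℕ, chainDepth a β j ≤ D' →
      ∃ S : Finset ℂ, S.card = j + 1 ∧
        (∀ ρ ∈ S, riemannZeta ρ = 0 ∧ ρ₀.re - chainDepth a β j ≤ ρ.re ∧ ρ₀.im ≤ ρ.im ∧
          ρ.im ≤ ρ₀.im + chainDepth a β j) ∧
        ∃ ρt ∈ S, ∀ ρ ∈ S, ρ.im ≤ ρt.im := by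
    intro j
    induction j with
    | zero =>
      intro _
      refine ⟨{ρ₀}, by simp, ?_, ⟨ρ₀, by simp, fun ρ hρ => by simp at hρ; rw [hρ]⟩⟩
      intro ρ hρ
      simp at hρ
      subst hρ
      simp [chainDepth]
      exact hζ₀
    | succ j ih =>
      intro hdj1
      have hdj : chainDepth a β j ≤ D' := le_trans (chainDepth_le_succ ha.le hβpos.le j) hdj1
      obtain ⟨S, hcard, hS, ρt, hρtS, htop⟩ := ih hdj
      obtain ⟨hζt, hret, himt₁, himt₂⟩ := hS ρt hρtS
      have hdnn : 0 ≤ chainDepth a β j := chainDepth_nonneg ha.le hβpos.le j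
      -- apply the step at `ρt` with depth `d_j`
      have habs : |ρt.im - ρ₀.im| ≤ 1 / 4 := by
        rw [abs_le]; constructor <;> linarith
      obtain ⟨ρ', hζ', him'₁, him'₂, hre'⟩ :=
        hT T hT₀ hHYP ρ₀ hζ₀ hre₀ him₁ him₂ hapex ρt hζt (chainDepth a β j) hdnn
          (le_trans hdj hD'D) hret habs
      rw [hg] at him'₂ hre'
      have hnotin : ρ' ∉ S := by
        intro h
        have := htop ρ' h
        linarith
      refine ⟨insert ρ' S, by rw [Finset.card_insert_of_notMem hnotin, hcard], ?_, ?_⟩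
      · intro ρ hρ
        rw [Finset.mem_insert] at hρ
        rcases hρ with rfl | hρ
        · refine ⟨hζ', ?_, ?_, ?_⟩
          · rw [chainDepth_succ]; linarith
          · linarith
          · rw [chainDepth_succ]; linarith
        · obtain ⟨h1, h2, h3, h4⟩ := hS ρ hρ
          have hmono := chainDepth_le_succ ha.le hβpos.le j
          exact ⟨h1, by linarith, h3, by linarith⟩
      · refine ⟨ρ', Finset.mem_insert_self _ _, fun ρ hρ => ?_⟩
        rw [Finset.mem_insert] at hρ
        rcases hρ with rfl | hρ
        · exact le_rfl
        · exact le_trans (htop ρ hρ) him'₁.le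
  -- the number of steps `k`
  set x : ℝ := Real.log (1 + a * D' / β) / Real.log (1 + a) with hx_def
  have hq : 0 < 1 + a * D' / β := by
    have : 0 < a * D' / β := div_pos (mul_pos ha hD'0) hβpos
    linarith
  have hx0 : 0 ≤ x := by
    rw [hx_def]
    refine div_nonneg (Real.log_nonneg ?_) hlog1a.le
    have : 0 ≤ a * D' / β := (div_pos (mul_pos ha hD'0) hβpos).le
    linarith
  set k : ℕ := ⌊x⌋₊ with hk_def
  have hkx : (k : ℝ) ≤ x := Nat.floor_le hx0
  have hxk : x < k + 1 := Nat.lt_floor_add_one x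
  -- `d_k ≤ D'`
  have hpow : (1 + a) ^ k ≤ 1 + a * D' / β := by
    have h1 : (1 + a) ^ k = Real.exp (k * Real.log (1 + a)) := by
      rw [Real.exp_nat_mul, Real.exp_log (by linarith)]
    have h2 : (k : ℝ) * Real.log (1 + a) ≤ x * Real.log (1 + a) :=
      mul_le_mul_of_nonneg_right hkx hlog1a.le
    have h3 : x * Real.log (1 + a) = Real.log (1 + a * D' / β) := by
      rw [hx_def, div_mul_cancel₀ _ hlog1a.ne']
    calc (1 + a) ^ k = Real.exp (k * Real.log (1 + a)) := h1
      _ ≤ Real.exp (x * Real.log (1 + a)) := Real.exp_le_exp.2 h2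
      _ = 1 + a * D' / β := by rw [h3, Real.exp_log hq]
  have hdk : chainDepth a β k ≤ D' := by
    rw [chainDepth_eq ha.ne' β k]
    have h1 : β * ((1 + a) ^ k - 1) ≤ β * (a * D' / β) := by
      refine mul_le_mul_of_nonneg_left ?_ hβpos.le
      linarith
    have h2 : β * (a * D' / β) = a * D' := by field_simp
    rw [div_le_iff₀ ha]
    calc β * ((1 + a) ^ k - 1) ≤ a * D' := by rw [← h2]; exact h1
      _ = D' * a := by ring
  -- the count `loglog T/(2 log(1+a)) ≤ k + 1`
  have hcount : 1 / (2 * Real.log (1 + a)) * Real.log (Real.log T) ≤ ((k + 1 : ℕ) : ℝ) := by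
    push_cast
    refine le_trans ?_ hxk.le
    -- suffices: `m/2 ≤ log(1 + aD'/β)`
    have hkey : m / 2 ≤ Real.log (1 + a * D' / β) := by
      rw [Real.le_log_iff_exp_le hq]
      -- `exp(m/2) ≤ a D'/β = a D' L/(b m²)`
      have hb2 : 0 < b * m ^ 2 := mul_pos hb (by positivity)
      have h1 : Real.exp (m / 2) ≤ a * D' / β := by
        rw [hβ_def, div_div_eq_mul_div, le_div_iff₀ hb2]
        -- `exp(m/2) · b m² ≤ a D' L`, with `L = exp m = exp(m/2)²`
        have h2 := count_aux ha hb hD'0 hm0 hm48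
        have h3 : L = Real.exp (m / 2) * Real.exp (m / 2) := by
          rw [← Real.exp_add, ← hLexp]; ring_nf
        calc Real.exp (m / 2) * (b * m ^ 2) ≤ Real.exp (m / 2) * (a * D' * Real.exp (m / 2)) := by
              gcongr
          _ = a * D' * L := by rw [h3]; ring
      linarith
    have : 1 / (2 * Real.log (1 + a)) * Real.log (Real.log T) = (m / 2) / Real.log (1 + a) := by
      rw [hm_def, hL_def]; field_simp
    rw [this, hx_def]
    exact div_le_div_of_nonneg_right hkey hlog1a.le
  -- conclude
  obtain ⟨S, hcard, hS, -⟩ := hchain k hdk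
  refine ⟨S, ?_, fun ρ hρ => ?_⟩
  · rw [hcard]; exact hcount
  · obtain ⟨h1, h2, h3, h4⟩ := hS ρ hρ
    refine ⟨h1, ?_, ?_⟩
    · have : chainDepth a β k ≤ η := le_trans hdk (le_trans hD'D hDη)
      linarith
    · rw [abs_le]; constructor <;> linarith

/-- The registered stub `stub_chainCount` of the skeleton `Cruxes/ClusterForcing/Lines/zero_chain.lean`
(crux stmt-RiemannHypothesis-14530), by name and signature. [this work] -/
theorem stub_chainCount : ChainCount := chainCount_proof

-- buildfix 2026-08-19: the BC2-redirect join `assembly2_proof : Assembly2` (route item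
-- stmt-RiemannHypothesis-17861) was removed here — `Fences.Assembly2` was DROPPED (moot) from the route on
-- 2026-08-17T05:07:39Z and the identifier no longer exists; `chainCount_proof : ChainCount`
-- (stmt-RiemannHypothesis-17856, still open) above is untouched.

end Summit.RiemannHypothesis.RiemannHypothesis.Theorems
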